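import Mathlib
import Literature.Analysis.FluidPDE.VectorCalculus

/-!
# Clause 13-R, route (ii′) item (c): ENERGY IDENTITY for the model adjoint equation — NO nonzero regular annihilator
# (crux `Clause13RNearStraightL`, stmt-NavierStokesRegularity-23612; line `rate_bordered_split`, STUB R `stub_rateRow13RFlat`)

Route `FilamentSkeletonRss`, Variant A1R.  Census item (c) of record for STUB R (exit reports of hands fsrs-8-g1 / fsrs-10-g0) asks for a
`C¹` weight `ψ` with `(D^*ψ)_k = 0` on every tangency ball and positive mass, to feed the certificate
`…Clause13RAdjointKernelCertificate.rateRow13RFlat_of_adjointKernelCertificate`; its MODEL (one straight axis `X u = p + u•d`, constant core,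
`…Clause13RAdjointStraightModelWeights`) is the equation, for a weight `φ` on the ball `S = [a, b]`,

  `cst • [m(σ) • (φ σ × d) − ∫_{τ ∈ S} k(τ − σ) • (φ τ × d) dτ] + ½ φ σ + α e × φ σ + w′(σ) φ σ + w(σ) φ′(σ) = 0`   (σ ∈ S),

with an EVEN scalar kernel `k` (there: `k(s) = 2K₃(s) − 3s²‖d‖²K₅(s) = (2q − s²)/(s²+q)^{5/2}` for `‖d‖ = 1`) and the slip `w` vanishing exactly once
in `S` (`w(a) ≤ 0 ≤ w(b)`).  THIS FILE PROVES THAT EVERY `C¹` SOLUTION OF THAT EQUATION VANISHES IDENTICALLY ON `S` as soon as `w′ > −1` on `S`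
(`model_adjoint_no_regular_annihilator`), and more generally an ENERGY IDENTITY for the sourced equation (`= h σ`) with an arbitrary
zeroth-order term `g` (`model_adjoint_energy_identity`), whence the a-priori bound `ε ∫_S ‖φ‖² ≤ ∫_S ⟪h, φ⟫` (`model_adjoint_apriori`).
Mechanism (three lines): pair the equation with `φ σ` and integrate over `S`;
* the local self-induction term dies pointwise (`⟪φ × d, φ⟫ = 0`), and so does the swirl term (`⟪e × φ, φ⟫ = 0`);
* the NONLOCAL term dies after integration: `(σ, τ) ↦ k(τ−σ)⟪φ τ × d, φ σ⟫` is antisymmetric (`k` even, triple product alternating), so its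
  integral over `S × S` vanishes (Fubini) — `setIntegral_inner_nonlocal_eq_zero`;
* the transport term integrates by parts: `∫_S (w′‖φ‖² + 2w⟪φ′, φ⟫) = w(b)‖φ(b)‖² − w(a)‖φ(a)‖² ≥ 0` — `integral_transport_eq`.
Hence `∫_S (⟪g, φ⟫ + ½ w′‖φ‖²) + ½(w(b)‖φ(b)‖² − w(a)‖φ(a)‖²) = ∫_S ⟪h, φ⟫`; with `g = ½φ + α e × φ` the left integrand is `½(1 + w′)‖φ‖²`.
CONSEQUENCE FOR THE PROGRAMME (planner-facing, recorded in the hand's memo): in the model the homogeneous adjoint equation has only the trivial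
bounded solution, so the annihilators of the range of the linearised map on CLAMPED test fields are not `C¹` weights but measures with atoms at the
ball EDGE plus an interior density solving the SOURCED equation (`h` = edge kernels); the a-priori bound here is the uniqueness/stability half of that
repaired item.  [folklore] (energy method for a transport + conservative nonlocal operator).
Hand `leafhand-ns-filamentskeletonrs-16-g0` (LAND-ONLY); `--supports stmt-NavierStokesRegularity-23612` helper, def-free.  HONEST FRAMING: an identity
for the MODEL adjoint equation attached to a HYPOTHETICAL filament skeleton on the NEGATIVE side of a MODEL blow-up route; STUB R is NOT proved here and
nothing in this file bears on Navier–Stokes regularity or blow-up.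
-/

noncomputable section

open MeasureTheory Filter Topology Set intervalIntegral
open scoped RealInnerProductSpace InnerProductSpace
open Literature.Analysis.FluidPDE

namespace Summit.NavierStokesRegularity.NavierStokesRegularity.Theorems.Clause13RAdjointEnergy
set_option linter.dupNamespace false

/-! ## §1 Pointwise algebra of the cross product (the orthogonalities `⟪x × d, x⟫ = 0 = ⟪e × x, x⟫` are the landed
`DepletionLadder.inner_cross_curl_left` / `inner_cross_curl_self`; they are re-derived inline below by the same three-line `simp; ring`) -/

/-- The triple product is alternating: `⟪x × d, y⟫ = −⟪y × d, x⟫`. [folklore] -/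
theorem inner_cross_left_swap (x y d : EuclideanSpace ℝ (Fin 3)) : ⟪cross x d, y⟫ = -⟪cross y d, x⟫ := by
  simp only [cross, cross_apply, PiLp.inner_apply, RCLike.inner_apply, conj_trivial, Fin.sum_univ_three,
    Matrix.cons_val_zero, Matrix.cons_val_one, Matrix.cons_val_two, Matrix.head_cons, Matrix.tail_cons]
  ring

/-! ## §2 The nonlocal term is conservative: its pairing with `φ` over `S × S` vanishes -/

/-- Antisymmetry of the nonlocal pairing density: `k(τ−σ)⟪φ τ × d, φ σ⟫ = −(k(σ−τ)⟪φ σ × d, φ τ⟫)` for an even kernel. [folklore] -/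
theorem nonlocal_density_antisymm {k : ℝ → ℝ} (hkev : ∀ s, k (-s) = k s) (φ : ℝ → EuclideanSpace ℝ (Fin 3))
    (d : EuclideanSpace ℝ (Fin 3)) (σ τ : ℝ) :
    k (τ - σ) * ⟪cross (φ τ) d, φ σ⟫ = -(k (σ - τ) * ⟪cross (φ σ) d, φ τ⟫) := by
  have hk : k (τ - σ) = k (σ - τ) := by rw [← hkev (σ - τ), neg_sub]
  rw [hk, inner_cross_left_swap (φ τ) (φ σ) d]
  ring

/-- **The nonlocal term pairs to zero.**  For a continuous even kernel `k` and a continuous weight `φ`,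
`∫_{σ∈[a,b]} ⟪∫_{τ∈[a,b]} k(τ−σ) • (φ τ × d) dτ, φ σ⟫ dσ = 0`. [folklore] -/
theorem setIntegral_inner_nonlocal_eq_zero {a b : ℝ} {k : ℝ → ℝ} (hk : Continuous k) (hkev : ∀ s, k (-s) = k s)
    {φ : ℝ → EuclideanSpace ℝ (Fin 3)} (hφ : Continuous φ) (d : EuclideanSpace ℝ (Fin 3)) :
    ∫ σ in Icc a b, ⟪∫ τ in Icc a b, k (τ - σ) • cross (φ τ) d, φ σ⟫ = 0 := by
  -- the density `F σ τ`
  set F : ℝ → ℝ → ℝ := fun σ τ => k (τ - σ) * ⟪cross (φ τ) d, φ σ⟫ with hF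
  have hcrossφ : Continuous fun τ => cross (φ τ) d := by
    have : Continuous fun τ => crossCLM (φ τ) d := (crossCLM.continuous₂).comp₂ hφ continuous_const
    simpa only [crossCLM_apply] using this
  have hFc : Continuous (Function.uncurry F) := by
    have h1 : Continuous fun p : ℝ × ℝ => k (p.2 - p.1) := hk.comp (continuous_snd.sub continuous_fst)
    have h2 : Continuous fun p : ℝ × ℝ => ⟪cross (φ p.2) d, φ p.1⟫ :=
      (hcrossφ.comp continuous_snd).inner (hφ.comp continuous_fst)
    exact h1.mul h2
  -- Step 1: pull `φ σ` into the inner integral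
  have hinner : ∀ σ, ⟪∫ τ in Icc a b, k (τ - σ) • cross (φ τ) d, φ σ⟫ = ∫ τ in Icc a b, F σ τ := by
    intro σ
    have hint : IntegrableOn (fun τ => k (τ - σ) • cross (φ τ) d) (Icc a b) :=
      ((hk.comp (continuous_id.sub continuous_const)).smul hcrossφ).continuousOn.integrableOn_compact isCompact_Icc
    rw [real_inner_comm, ← integral_inner hint (φ σ)]
    refine integral_congr_ae (Eventually.of_forall fun τ => ?_)
    simp only [hF, inner_smul_right, real_inner_comm (φ σ)]
  simp_rw [hinner]
  -- Step 2: Fubini on the compact square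
  have hprod : Integrable (Function.uncurry F) ((volume.restrict (Icc a b)).prod (volume.restrict (Icc a b))) := by
    rw [Measure.prod_restrict]
    exact hFc.continuousOn.integrableOn_compact (isCompact_Icc.prod isCompact_Icc)
  have hswap : ∫ σ in Icc a b, ∫ τ in Icc a b, F σ τ = ∫ τ in Icc a b, ∫ σ in Icc a b, F σ τ :=
    integral_integral_swap hprod
  -- Step 3: antisymmetry
  have hanti : ∫ τ in Icc a b, ∫ σ in Icc a b, F σ τ = -∫ τ in Icc a b, ∫ σ in Icc a b, F τ σ := by
    rw [← MeasureTheory.integral_neg]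
    refine integral_congr_ae (Eventually.of_forall fun τ => ?_)
    simp only
    rw [← MeasureTheory.integral_neg]
    refine integral_congr_ae (Eventually.of_forall fun σ => ?_)
    simp only [hF]
    exact nonlocal_density_antisymm hkev φ d σ τ
  have hself : ∫ σ in Icc a b, ∫ τ in Icc a b, F σ τ = -∫ σ in Icc a b, ∫ τ in Icc a b, F σ τ := hswap.trans hanti
  linarith

/-! ## §3 The transport term integrates to a boundary term -/

/-- **Transport identity**: `∫_a^b (w′‖φ‖² + 2w⟪φ′, φ⟫) = w(b)‖φ(b)‖² − w(a)‖φ(a)‖²`. [folklore] -/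
theorem integral_transport_eq {a b : ℝ} {w w' : ℝ → ℝ} {φ φ' : ℝ → EuclideanSpace ℝ (Fin 3)}
    (hw : ∀ σ, HasDerivAt w (w' σ) σ) (hφ : ∀ σ, HasDerivAt φ (φ' σ) σ) (hw'c : Continuous w') (hφ'c : Continuous φ') :
    ∫ σ in a..b, (w' σ * ‖φ σ‖ ^ 2 + 2 * w σ * ⟪φ' σ, φ σ⟫) = w b * ‖φ b‖ ^ 2 - w a * ‖φ a‖ ^ 2 := by
  have hwc : Continuous w := continuous_iff_continuousAt.2 fun σ => (hw σ).continuousAt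
  have hφc : Continuous φ := continuous_iff_continuousAt.2 fun σ => (hφ σ).continuousAt
  have hderiv : ∀ σ ∈ uIcc a b, HasDerivAt (fun σ => w σ * ‖φ σ‖ ^ 2) (w' σ * ‖φ σ‖ ^ 2 + 2 * w σ * ⟪φ' σ, φ σ⟫) σ := by
    intro σ _
    have h1 := (hφ σ).norm_sq
    have h2 := (hw σ).mul h1
    have : w' σ * ‖φ σ‖ ^ 2 + 2 * w σ * ⟪φ' σ, φ σ⟫ = w' σ * ‖φ σ‖ ^ 2 + w σ * (2 * ⟪φ σ, φ' σ⟫) := by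
      rw [real_inner_comm]; ring
    rw [this]
    exact h2
  have hint : IntervalIntegrable (fun σ => w' σ * ‖φ σ‖ ^ 2 + 2 * w σ * ⟪φ' σ, φ σ⟫) volume a b :=
    ((hw'c.mul (hφc.norm.pow 2)).add ((continuous_const.mul hwc).mul (hφ'c.inner hφc))).intervalIntegrable _ _
  rw [integral_eq_sub_of_hasDerivAt hderiv hint]

/-! ## §4 The energy identity and its consequences -/

/-- **ENERGY IDENTITY for the (sourced) model adjoint equation.**  If `φ ∈ C¹` solves on `S = [a,b]`
`cst • (m σ • (φ σ × d) − ∫_{τ∈S} k(τ−σ) • (φ τ × d) dτ) + g σ + w′ σ • φ σ + w σ • φ′ σ = h σ` with `k` continuous and even, then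
`∫_a^b (⟪g, φ⟫ + ½ w′‖φ‖²) + ½ (w(b)‖φ(b)‖² − w(a)‖φ(a)‖²) = ∫_a^b ⟪h, φ⟫`. [folklore] -/
theorem model_adjoint_energy_identity {a b cst : ℝ} (hab : a ≤ b) {k m w w' : ℝ → ℝ}
    {φ φ' g h : ℝ → EuclideanSpace ℝ (Fin 3)} {d : EuclideanSpace ℝ (Fin 3)}
    (hk : Continuous k) (hkev : ∀ s, k (-s) = k s)
    (hw : ∀ σ, HasDerivAt w (w' σ) σ) (hφ : ∀ σ, HasDerivAt φ (φ' σ) σ) (hw'c : Continuous w') (hφ'c : Continuous φ')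
    (hg : Continuous g)
    (heq : ∀ σ ∈ Icc a b,
      cst • (m σ • cross (φ σ) d - ∫ τ in Icc a b, k (τ - σ) • cross (φ τ) d) + g σ + w' σ • φ σ + w σ • φ' σ = h σ) :
    (∫ σ in a..b, (⟪g σ, φ σ⟫ + 1 / 2 * w' σ * ‖φ σ‖ ^ 2)) + 1 / 2 * (w b * ‖φ b‖ ^ 2 - w a * ‖φ a‖ ^ 2)
      = ∫ σ in a..b, ⟪h σ, φ σ⟫ := by
  have hwc : Continuous w := continuous_iff_continuousAt.2 fun σ => (hw σ).continuousAt
  have hφc : Continuous φ := continuous_iff_continuousAt.2 fun σ => (hφ σ).continuousAt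
  -- pointwise pairing of the equation with `φ σ`
  have hpt : ∀ σ ∈ Icc a b,
      ⟪h σ, φ σ⟫ = -cst * ⟪∫ τ in Icc a b, k (τ - σ) • cross (φ τ) d, φ σ⟫
        + (⟪g σ, φ σ⟫ + 1 / 2 * w' σ * ‖φ σ‖ ^ 2) + 1 / 2 * (w' σ * ‖φ σ‖ ^ 2 + 2 * w σ * ⟪φ' σ, φ σ⟫) := by
    intro σ hσ
    have hx0 : ⟪cross (φ σ) d, φ σ⟫ = 0 := by
      have h := inner_cross_left_swap (φ σ) (φ σ) d
      linarith
    rw [← heq σ hσ]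
    simp only [inner_add_left, inner_sub_left, inner_smul_left, conj_trivial, hx0, real_inner_self_eq_norm_sq]
    ring
  -- integrate over `[a,b]`
  have hI : ∫ σ in a..b, ⟪h σ, φ σ⟫ = ∫ σ in a..b, (-cst * ⟪∫ τ in Icc a b, k (τ - σ) • cross (φ τ) d, φ σ⟫
        + (⟪g σ, φ σ⟫ + 1 / 2 * w' σ * ‖φ σ‖ ^ 2) + 1 / 2 * (w' σ * ‖φ σ‖ ^ 2 + 2 * w σ * ⟪φ' σ, φ σ⟫)) := by
    refine integral_congr fun σ hσ => ?_
    rw [uIcc_of_le hab] at hσ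
    exact hpt σ hσ
  -- continuity of the nonlocal weight (parametric integral over a compact set)
  have hcrossφ : Continuous fun τ => cross (φ τ) d := by
    have : Continuous fun τ => crossCLM (φ τ) d := (crossCLM.continuous₂).comp₂ hφc continuous_const
    simpa only [crossCLM_apply] using this
  have hNc : Continuous fun σ => ∫ τ in Icc a b, k (τ - σ) • cross (φ τ) d := by
    have hj : Continuous (Function.uncurry fun σ τ => k (τ - σ) • cross (φ τ) d) :=
      (hk.comp (continuous_snd.sub continuous_fst)).smul (hcrossφ.comp continuous_snd)
    exact continuous_parametric_integral_of_continuous hj isCompact_Icc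
  have hi1 : IntervalIntegrable (fun σ => -cst * ⟪∫ τ in Icc a b, k (τ - σ) • cross (φ τ) d, φ σ⟫) volume a b :=
    (continuous_const.mul (hNc.inner hφc)).intervalIntegrable _ _
  have hi2 : IntervalIntegrable (fun σ => ⟪g σ, φ σ⟫ + 1 / 2 * w' σ * ‖φ σ‖ ^ 2) volume a b :=
    ((hg.inner hφc).add ((continuous_const.mul hw'c).mul (hφc.norm.pow 2))).intervalIntegrable _ _
  have hi3 : IntervalIntegrable (fun σ => 1 / 2 * (w' σ * ‖φ σ‖ ^ 2 + 2 * w σ * ⟪φ' σ, φ σ⟫)) volume a b :=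
    (continuous_const.mul ((hw'c.mul (hφc.norm.pow 2)).add
      ((continuous_const.mul hwc).mul (hφ'c.inner hφc)))).intervalIntegrable _ _
  rw [integral_add (hi1.add hi2) hi3, integral_add hi1 hi2, intervalIntegral.integral_const_mul,
    intervalIntegral.integral_const_mul, integral_transport_eq hw hφ hw'c hφ'c] at hI
  -- the nonlocal integral vanishes
  have hN0 : ∫ σ in a..b, ⟪∫ τ in Icc a b, k (τ - σ) • cross (φ τ) d, φ σ⟫ = 0 := by
    rw [integral_of_le hab, ← integral_Icc_eq_integral_Ioc]
    exact setIntegral_inner_nonlocal_eq_zero hk hkev hφc d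
  rw [hN0, mul_zero, zero_add] at hI
  linarith

/-- **A-PRIORI BOUND (uniqueness/stability half of the repaired item (c′)).**  Under the energy-identity hypotheses, if the slip changes sign across
the ball (`w(a) ≤ 0 ≤ w(b)`) and the zeroth-order part is coercive ALONG the solution, `ε‖φ σ‖² ≤ ⟪g σ, φ σ⟫ + ½ w′(σ)‖φ σ‖²` on `S`, then
`ε ∫_a^b ‖φ‖² ≤ ∫_a^b ⟪h, φ⟫`. [folklore] -/
theorem model_adjoint_apriori {a b cst ε : ℝ} (hab : a ≤ b) {k m w w' : ℝ → ℝ}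
    {φ φ' g h : ℝ → EuclideanSpace ℝ (Fin 3)} {d : EuclideanSpace ℝ (Fin 3)}
    (hk : Continuous k) (hkev : ∀ s, k (-s) = k s)
    (hw : ∀ σ, HasDerivAt w (w' σ) σ) (hφ : ∀ σ, HasDerivAt φ (φ' σ) σ) (hw'c : Continuous w') (hφ'c : Continuous φ')
    (hg : Continuous g) (hwa : w a ≤ 0) (hwb : 0 ≤ w b)
    (hcoer : ∀ σ ∈ Icc a b, ε * ‖φ σ‖ ^ 2 ≤ ⟪g σ, φ σ⟫ + 1 / 2 * w' σ * ‖φ σ‖ ^ 2)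
    (heq : ∀ σ ∈ Icc a b,
      cst • (m σ • cross (φ σ) d - ∫ τ in Icc a b, k (τ - σ) • cross (φ τ) d) + g σ + w' σ • φ σ + w σ • φ' σ = h σ) :
    ε * ∫ σ in a..b, ‖φ σ‖ ^ 2 ≤ ∫ σ in a..b, ⟪h σ, φ σ⟫ := by
  have hφc : Continuous φ := continuous_iff_continuousAt.2 fun σ => (hφ σ).continuousAt
  have hE := model_adjoint_energy_identity hab hk hkev hw hφ hw'c hφ'c hg heq
  have hbd : 0 ≤ 1 / 2 * (w b * ‖φ b‖ ^ 2 - w a * ‖φ a‖ ^ 2) := by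
    have h1 : 0 ≤ w b * ‖φ b‖ ^ 2 := mul_nonneg hwb (sq_nonneg _)
    have h2 : w a * ‖φ a‖ ^ 2 ≤ 0 := mul_nonpos_of_nonpos_of_nonneg hwa (sq_nonneg _)
    linarith
  have hmono : ∫ σ in a..b, ε * ‖φ σ‖ ^ 2 ≤ ∫ σ in a..b, (⟪g σ, φ σ⟫ + 1 / 2 * w' σ * ‖φ σ‖ ^ 2) := by
    refine integral_mono_on hab ((continuous_const.mul (hφc.norm.pow 2)).intervalIntegrable _ _)
      (((hg.inner hφc).add ((continuous_const.mul hw'c).mul (hφc.norm.pow 2))).intervalIntegrable _ _) ?_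
    intro σ hσ
    exact hcoer σ hσ
  rw [intervalIntegral.integral_const_mul] at hmono
  linarith

/-- **NO NONZERO REGULAR SOLUTION (homogeneous equation, general coercive zeroth-order part).**  With `h = 0`, `a < b`, `w(a) ≤ 0 ≤ w(b)`
and `ε‖φ‖² ≤ ⟪g, φ⟫ + ½ w′‖φ‖²` along the solution (`ε > 0`), every `C¹` solution vanishes on `S = [a,b]`.  (For `a = b` the statement is
false: the ball is a point and the equation is a single linear condition.) [folklore] -/
theorem model_adjoint_eq_zero_of_coercive {a b cst ε : ℝ} (hab : a < b) (hε : 0 < ε) {k m w w' : ℝ → ℝ}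
    {φ φ' g : ℝ → EuclideanSpace ℝ (Fin 3)} {d : EuclideanSpace ℝ (Fin 3)}
    (hk : Continuous k) (hkev : ∀ s, k (-s) = k s)
    (hw : ∀ σ, HasDerivAt w (w' σ) σ) (hφ : ∀ σ, HasDerivAt φ (φ' σ) σ) (hw'c : Continuous w') (hφ'c : Continuous φ')
    (hg : Continuous g) (hwa : w a ≤ 0) (hwb : 0 ≤ w b)
    (hcoer : ∀ σ ∈ Icc a b, ε * ‖φ σ‖ ^ 2 ≤ ⟪g σ, φ σ⟫ + 1 / 2 * w' σ * ‖φ σ‖ ^ 2)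
    (heq : ∀ σ ∈ Icc a b,
      cst • (m σ • cross (φ σ) d - ∫ τ in Icc a b, k (τ - σ) • cross (φ τ) d) + g σ + w' σ • φ σ + w σ • φ' σ = 0) :
    ∀ σ ∈ Icc a b, φ σ = 0 := by
  have hφc : Continuous φ := continuous_iff_continuousAt.2 fun σ => (hφ σ).continuousAt
  have heq' : ∀ σ ∈ Icc a b, cst • (m σ • cross (φ σ) d - ∫ τ in Icc a b, k (τ - σ) • cross (φ τ) d) + g σ
      + w' σ • φ σ + w σ • φ' σ = (fun _ => (0 : EuclideanSpace ℝ (Fin 3))) σ := fun σ hσ => heq σ hσ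
  have hA := model_adjoint_apriori hab.le hk hkev hw hφ hw'c hφ'c hg hwa hwb hcoer heq'
  simp only [inner_zero_left, intervalIntegral.integral_zero] at hA
  -- `ε ∫_a^b ‖φ‖² ≤ 0`; if `φ σ₀ ≠ 0` for some `σ₀ ∈ [a,b]` the integral of the continuous nonnegative `‖φ‖²` is positive
  intro σ hσ
  by_contra hne
  have hpos : 0 < ‖φ σ‖ ^ 2 := by positivity
  have hcont2 : Continuous fun σ => ‖φ σ‖ ^ 2 := hφc.norm.pow 2
  have hlt : (∫ x in a..b, (fun _ => (0 : ℝ)) x) < ∫ x in a..b, ‖φ x‖ ^ 2 :=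
    intervalIntegral.integral_lt_integral_of_continuousOn_of_le_of_exists_lt hab continuousOn_const hcont2.continuousOn
      (fun x _ => sq_nonneg _) ⟨σ, hσ, hpos⟩
  simp only [intervalIntegral.integral_zero] at hlt
  have : 0 < ε * ∫ x in a..b, ‖φ x‖ ^ 2 := mul_pos hε hlt
  linarith

/-- **NO NONZERO REGULAR ANNIHILATOR for the model adjoint equation of census item (c).**  On the ball `S = [a,b]` (`a < b`), let the slip `w ∈ C¹`
satisfy `w(a) ≤ 0 ≤ w(b)` and `w′ ≥ −1 + 2ε` on `S` (`ε > 0`), let `k` be a continuous even kernel, `m` any scalar weight, `cst, α` any constants and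
`d, e` any vectors.  Then every `C¹` solution `φ` of
`cst • (m σ • (φ σ × d) − ∫_{τ∈S} k(τ−σ) • (φ τ × d) dτ) + ½ φ σ + α e × φ σ + w′ σ φ σ + w σ φ′ σ = 0` (σ ∈ S)
vanishes identically on `S`.  In the currency of `…Clause13RAdjointStraightModelWeights` (`m = ∫K₃`, `k = 2K₃ − 3s²‖d‖²K₅`, `cst = Γγ/4π`,
`e = e₃`): the homogeneous model adjoint equation has NO solution of positive mass, so item (c) as typed («`ψ ∈ C¹`, `(D^*ψ)_k = 0` on `S_k`,
`Σ∫‖ψ‖ > 0`») is void at model level in the regime `w′ > −1`; the cokernel lives in edge measures (see the module docstring). [folklore] -/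
theorem model_adjoint_no_regular_annihilator {a b cst α ε : ℝ} (hab : a < b) (hε : 0 < ε) {k m w w' : ℝ → ℝ}
    {φ φ' : ℝ → EuclideanSpace ℝ (Fin 3)} {d e : EuclideanSpace ℝ (Fin 3)}
    (hk : Continuous k) (hkev : ∀ s, k (-s) = k s)
    (hw : ∀ σ, HasDerivAt w (w' σ) σ) (hφ : ∀ σ, HasDerivAt φ (φ' σ) σ) (hw'c : Continuous w') (hφ'c : Continuous φ')
    (hwa : w a ≤ 0) (hwb : 0 ≤ w b) (hgrowth : ∀ σ ∈ Icc a b, -1 + 2 * ε ≤ w' σ)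
    (heq : ∀ σ ∈ Icc a b,
      cst • (m σ • cross (φ σ) d - ∫ τ in Icc a b, k (τ - σ) • cross (φ τ) d)
        + (1 / 2 : ℝ) • φ σ + α • cross e (φ σ) + w' σ • φ σ + w σ • φ' σ = 0) :
    ∀ σ ∈ Icc a b, φ σ = 0 := by
  have hφc : Continuous φ := continuous_iff_continuousAt.2 fun σ => (hφ σ).continuousAt
  have hcrossφ : Continuous fun τ => cross e (φ τ) := by
    have : Continuous fun τ => crossCLM e (φ τ) := (crossCLM.continuous₂).comp₂ continuous_const hφc
    simpa only [crossCLM_apply] using this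
  have h1 : Continuous fun σ => (1 / 2 : ℝ) • φ σ := hφc.const_smul (1 / 2 : ℝ)
  have h2 : Continuous fun σ => α • cross e (φ σ) := hcrossφ.const_smul α
  have hg : Continuous fun σ => (1 / 2 : ℝ) • φ σ + α • cross e (φ σ) := h1.add h2
  refine model_adjoint_eq_zero_of_coercive (cst := cst) (m := m) (d := d)
    (g := fun σ => (1 / 2 : ℝ) • φ σ + α • cross e (φ σ)) hab hε hk hkev hw hφ hw'c hφ'c hg hwa hwb ?_ ?_
  · intro σ hσ
    have he0 : ⟪cross e (φ σ), φ σ⟫ = 0 := by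
      simp only [cross, cross_apply, PiLp.inner_apply, RCLike.inner_apply, conj_trivial, Fin.sum_univ_three,
        Matrix.cons_val_zero, Matrix.cons_val_one, Matrix.cons_val_two, Matrix.head_cons, Matrix.tail_cons]
      ring
    simp only [inner_add_left, inner_smul_left, conj_trivial, he0, real_inner_self_eq_norm_sq, mul_zero,
      add_zero]
    have h1 := hgrowth σ hσ
    have h2 : 0 ≤ ‖φ σ‖ ^ 2 := sq_nonneg _
    nlinarith
  · intro σ hσ
    rw [← heq σ hσ]
    simp only [add_assoc]

/-! ## §5 The model kernel of `…Clause13RAdjointStraightModelWeights` is continuous and even -/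

/-- The straight-axis self kernel `k(s) = 2K₃(s) − 3s²‖d‖²K₅(s)`, `K_p(s) = ((s²‖d‖² + q)^{p/2})⁻¹`, is even. [folklore] -/
theorem model_kernel_even (d : EuclideanSpace ℝ (Fin 3)) (q s : ℝ) :
    (2 * ((((-s) ^ 2 * ‖d‖ ^ 2 + q) ^ (3 / 2 : ℝ))⁻¹) - 3 * (-s) ^ 2 * ‖d‖ ^ 2 * (((-s) ^ 2 * ‖d‖ ^ 2 + q) ^ (5 / 2 : ℝ))⁻¹)
      = 2 * (((s ^ 2 * ‖d‖ ^ 2 + q) ^ (3 / 2 : ℝ))⁻¹) - 3 * s ^ 2 * ‖d‖ ^ 2 * ((s ^ 2 * ‖d‖ ^ 2 + q) ^ (5 / 2 : ℝ))⁻¹ := by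
  rw [neg_sq]

/-- … and continuous when the core is positive (`q > 0`). [folklore] -/
theorem model_kernel_continuous (d : EuclideanSpace ℝ (Fin 3)) {q : ℝ} (hq : 0 < q) :
    Continuous fun s : ℝ =>
      2 * (((s ^ 2 * ‖d‖ ^ 2 + q) ^ (3 / 2 : ℝ))⁻¹) - 3 * s ^ 2 * ‖d‖ ^ 2 * ((s ^ 2 * ‖d‖ ^ 2 + q) ^ (5 / 2 : ℝ))⁻¹ := by
  have hbase : Continuous fun s : ℝ => s ^ 2 * ‖d‖ ^ 2 + q := ((continuous_id.pow 2).mul continuous_const).add continuous_const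
  have hpos : ∀ s : ℝ, 0 < s ^ 2 * ‖d‖ ^ 2 + q := fun s => by positivity
  have h3 : Continuous fun s : ℝ => ((s ^ 2 * ‖d‖ ^ 2 + q) ^ (3 / 2 : ℝ))⁻¹ :=
    (hbase.rpow_const fun s => Or.inr (by norm_num)).inv₀ fun s => (Real.rpow_pos_of_pos (hpos s) _).ne'
  have h5 : Continuous fun s : ℝ => ((s ^ 2 * ‖d‖ ^ 2 + q) ^ (5 / 2 : ℝ))⁻¹ :=
    (hbase.rpow_const fun s => Or.inr (by norm_num)).inv₀ fun s => (Real.rpow_pos_of_pos (hpos s) _).ne'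
  exact (continuous_const.mul h3).sub ((((continuous_const.mul (continuous_id.pow 2)).mul continuous_const)).mul h5)

end Summit.NavierStokesRegularity.NavierStokesRegularity.Theorems.Clause13RAdjointEnergy

end
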